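import Summits.ResolutionOfSingularities.ResolutionOfSingularities.Theorems.FrobeniusClosingPatchingRelPerfectDepthRadicalEquimultiple
import Literature.AlgebraicGeometry.Resolution.BlowupChartMembership
import Literature.AlgebraicGeometry.Resolution.RegularCentreRsopGenerated
import Literature.AlgebraicGeometry.Resolution.StalkSpecializesLocalization
import Literature.AlgebraicGeometry.Resolution.PrimeDivisorIdeals
import Literature.AlgebraicGeometry.Resolution.SymbolicPowersRegularQuotient
import Literature.AlgebraicGeometry.Resolution.CanonicalResolutionSmoothCentre
import Literature.AlgebraicGeometry.Resolution.OrderSemicontinuityPointwise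
import HarnessLib

/-!
# Crux `PatchingRelPerfect` (stmt-ResolutionOfSingularities-16161), chain W5.2 — F7(β) (β-AX) T3 extraction glue, LAYER C:
# the v7 exponent `m i` is the order of the host trace at EVERY point of the centre

[OURS · L1 W5.2 · F7(β) (β-AX) · res-L1-w52-plan-1 NAMING G12-22 «(EQ-glue) layer C», item (C1)] res-L1-w52-stub-1 g5.  Replaces the role of NO
printed item; NOT a statement of the manuscript under review (AI-written, weaker than expert review).

The v7 `StepStable` binders pin the exponent `m i` by `cyl.tr i ≤ C ^ m i` and `¬ cyl.tr i ≤ C ^ (m i + 1)` — a GLOBAL pair of conditions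
along the (irreducible, regular) centre `V(C)`.  With the extraction lemma (layers A/B: every host trace is equimultiple along the centre at
every point) this pins the order POINTWISE: **`trace_idealOrder_eq : idealOrder (tr i) z = m i` at every `z ∈ V(C)`**, and
`mem_support_trace_iff : z ∈ Supp (tr i) ↔ m i ≠ 0`.  Route: `≥` is stalkwise from `tr i ≤ C ^ m`; for `≤`, an order `≥ m + 1` at one
`z` gives `(tr i)_z ≤ C_z^{m+1}` (equimultiplicity `trace_mOrder_eq_mOrder_localization` + `P⁽ⁿ⁾ = Pⁿ` for the regular prime `C_z`,
`comap_map_pow_eq_pow_of_isRegularLocalRing_quotient`), which generises to the generic point `η` of `V(C)` (`stalkIdeal_map_stalkSpecializes`),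
specialises back to every point of `V(C)` (`idealOrder_le_of_specializes`) and so forces `tr i ≤ C ^ (m+1)`
(`le_pow_of_isRegular_subscheme_of_forall_le_idealOrder_of_isRegular`) — contradiction.  Stated on any locally Noetherian regular scheme
and any finite family of effective Cartier traces, hypotheses = the v7 binder texts.  Item (C2) (X-side transport along the retraction) is
CylState/param-lift bookkeeping and is not in this file.  Fact-free.
-/

-- `Summit.<Summit>.<Sub>.Theorems` with `Sub = Summit` (single-conjunct summit, D-0017)
set_option linter.dupNamespace false

noncomputable section

open IsLocalRing CategoryTheory AlgebraicGeometry TopologicalSpace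
open Literature.RingTheory.HilbertSamuel Literature.AlgebraicGeometry.Resolution Scheme.IdealSheafData

namespace Summit.ResolutionOfSingularities.ResolutionOfSingularities.Theorems.DepthEquimultiple

universe u

variable {Z : Scheme.{u}} [IsLocallyNoetherian Z]

omit [IsLocallyNoetherian Z] in
/-- `I ≤ C ^ m` bounds the order of `I` from below at every point of `V(C)`. [folklore] -/
theorem le_idealOrder_of_le_pow {I C : Z.IdealSheafData} {m : ℕ} (hm : I ≤ C ^ m) {z : Z} (hz : z ∈ (C.support : Set Z)) :
    (m : ℕ∞) ≤ idealOrder I z := by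
  rw [le_idealOrder_iff]
  refine (stalkIdeal_mono hm z).trans ?_
  rw [stalkIdeal_pow]
  exact Ideal.pow_right_mono ((mem_support_iff_stalkIdeal_le C z).mp hz) m

/-- [OURS · L1 W5.2 · F7(β) (β-AX) T3 glue, layer C] **The v7 exponent is the order of the trace at EVERY point of the centre.**  On a regular
locally Noetherian scheme `Z`, for effective Cartier traces `tr i` with reduced total trace `D = ⋃ i, Supp (tr i)`, a centre ideal `C` with
`V(C)` regular and irreducible (generic point `η`), `𝓘(D) ≤ C`, the v7 permissibility binder at every point of `V(C)`, and the exponent pair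
`tr i ≤ C ^ m`, `¬ tr i ≤ C ^ (m + 1)`: `idealOrder (tr i) z = m` for every `z ∈ V(C)`. [cite: CossartJannsenSaito2020, Thm. 3.3]
[cite: BierstoneGrigorievMilmanWlodarczyk2011, Lemma 3.2.1 (1)] -/
theorem trace_idealOrder_eq (hZ : Scheme.IsRegular Z) {ι : Type*} [Fintype ι] (tr : ι → Z.IdealSheafData)
    (htr : ∀ i, IsEffectiveCartier (tr i)) (D : Closeds Z) (hD : (D : Set Z) = ⋃ i, ((tr i).support : Set Z)) (C : Z.IdealSheafData)
    (hC : Scheme.IsRegular C.subscheme) {η : Z} (hη : IsGenericPoint η (C.support : Set Z)) (hsub : vanishingIdeal D ≤ C)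
    (hperm : ∀ x ∈ (C.support : Set Z), ((stalkIdeal C x).map (Ideal.Quotient.mk (stalkIdeal (vanishingIdeal D) x))).IsPermissible)
    (i : ι) {m : ℕ} (hm : tr i ≤ C ^ m) (hm' : ¬ tr i ≤ C ^ (m + 1)) {z : Z} (hz : z ∈ (C.support : Set Z)) :
    idealOrder (tr i) z = m := by
  classical
  haveI : IsRegularLocalRing (Z.presheaf.stalk z) := hZ z
  haveI hq : IsRegularLocalRing ((Z.presheaf.stalk z) ⧸ stalkIdeal C z) := isRegularLocalRing_stalk_quotient_stalkIdeal hC hz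
  haveI : (stalkIdeal C z).IsPrime := (Ideal.Quotient.isDomain_iff_prime _).mp (isDomain_of_isRegularLocalRing _)
  refine le_antisymm ?_ (le_idealOrder_of_le_pow hm hz)
  -- suppose the order at `z` were `≥ m + 1`
  by_contra hlt
  have hge : ((m + 1 : ℕ) : ℕ∞) ≤ idealOrder (tr i) z := by
    rw [not_le] at hlt
    exact Order.add_one_le_of_lt (by exact_mod_cast hlt)
  -- then `(tr i)_z ≤ C_z^{m+1}` by equimultiplicity and `P⁽ⁿ⁾ = Pⁿ`
  obtain ⟨g, -, hg⟩ := IsEffectiveCartier.exists_stalkIdeal_eq_span (htr i) z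
  set p := stalkIdeal C z with hp_def
  set Sp := Localization.AtPrime p
  have hgm : g ∈ maximalIdeal (Z.presheaf.stalk z) ^ (m + 1) := by
    have := (le_idealOrder_iff (tr i) z (m + 1)).mp hge
    rw [hg, Ideal.span_singleton_le_iff_mem] at this
    exact this
  have hEQ := trace_mOrder_eq_mOrder_localization tr htr D hD C hsub (hperm z hz) i hg
  have hgp : g ∈ p ^ (m + 1) := by
    have h1 : ((m + 1 : ℕ) : ℕ∞) ≤ mOrder (algebraMap _ Sp g) := by rw [← hEQ, le_mOrder_iff]; exact hgm
    rw [le_mOrder_iff, ← Localization.AtPrime.map_eq_maximalIdeal, ← Ideal.map_pow] at h1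
    rw [← comap_map_pow_eq_pow_of_isRegularLocalRing_quotient p Sp (m + 1)]
    exact Ideal.mem_comap.mpr h1
  have hz' : stalkIdeal (tr i) z ≤ stalkIdeal (C ^ (m + 1)) z := by
    rw [hg, Ideal.span_singleton_le_iff_mem, stalkIdeal_pow]; exact hgp
  -- generise to the generic point of the centre …
  have hηz : η ⤳ z := hη.specializes hz
  have hη' : stalkIdeal (tr i) η ≤ stalkIdeal (C ^ (m + 1)) η := by
    rw [← stalkIdeal_map_stalkSpecializes (tr i) hηz, ← stalkIdeal_map_stalkSpecializes (C ^ (m + 1)) hηz]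
    exact Ideal.map_mono hz'
  have hordη : ((m + 1 : ℕ) : ℕ∞) ≤ idealOrder (tr i) η := by
    rw [le_idealOrder_iff]
    refine hη'.trans ?_
    rw [stalkIdeal_pow]
    exact Ideal.pow_right_mono ((mem_support_iff_stalkIdeal_le C η).mp hη.mem) _
  -- … and specialise back to every point of the centre
  have hall : ∀ y ∈ C.support, ((m + 1 : ℕ) : ℕ∞) ≤ idealOrder (tr i) y := fun y hy => by
    haveI : IsRegularLocalRing (Z.presheaf.stalk y) := hZ y
    exact hordη.trans (idealOrder_le_of_specializes (hη.specializes hy) (tr i))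
  exact hm' (le_pow_of_isRegular_subscheme_of_forall_le_idealOrder_of_isRegular hZ hC hall)

/-- [OURS · layer C] Hence, on the centre, **the trace passes through `z` iff its exponent is non-zero** (`x ∉ Supp (cyl.tr i) ↔ m i = 0`).
[folklore] -/
theorem mem_support_trace_iff (hZ : Scheme.IsRegular Z) {ι : Type*} [Fintype ι] (tr : ι → Z.IdealSheafData)
    (htr : ∀ i, IsEffectiveCartier (tr i)) (D : Closeds Z) (hD : (D : Set Z) = ⋃ i, ((tr i).support : Set Z)) (C : Z.IdealSheafData)
    (hC : Scheme.IsRegular C.subscheme) {η : Z} (hη : IsGenericPoint η (C.support : Set Z)) (hsub : vanishingIdeal D ≤ C)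
    (hperm : ∀ x ∈ (C.support : Set Z), ((stalkIdeal C x).map (Ideal.Quotient.mk (stalkIdeal (vanishingIdeal D) x))).IsPermissible)
    (i : ι) {m : ℕ} (hm : tr i ≤ C ^ m) (hm' : ¬ tr i ≤ C ^ (m + 1)) {z : Z} (hz : z ∈ (C.support : Set Z)) :
    z ∈ (tr i).support ↔ m ≠ 0 := by
  rw [← one_le_idealOrder_iff, trace_idealOrder_eq hZ tr htr D hD C hC hη hsub hperm i hm hm' hz]
  constructor
  · intro h h0; rw [h0] at h; exact absurd h (by decide)
  · intro h; exact_mod_cast Nat.one_le_iff_ne_zero.mpr h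

end Summit.ResolutionOfSingularities.ResolutionOfSingularities.Theorems.DepthEquimultiple

end
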